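import Mathlib
import Summits.Ventures.HodgeRepro.GaussSumEvenConductor

/-!
# GaussSumOddConductor — the Gauss sum of any primitive character reduces to a sum over the `ψ`-annihilator of `I`

Blind re-derivation cell `pub-hodge-repro`, seat night-2 (gen 5).  Target tree path
`lean/Summits/Ventures/HodgeRepro/GaussSumOddConductor.lean`.  The companion of `GaussSumEvenConductor.lean` for the
general case: on a finite commutative ring `R`, an ideal `I` with `I · I = 0`, an additive character `ψ`, a
character `ρ` with `ρ(1 + z) = ψ(a z)` on `I` (`a` a unit), gen 1's coset averaging leaves the units `y` with
`a + y ∈ A := Ann_ψ(I)`, i.e. the coset `−a(1 + A)` when `1 + A` consists of units; hence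

  **`∑_{y ∈ R^×} ρ(y) ψ(y) = ρ(−a) ψ(−a) · ∑_{w ∈ A} ρ(1 + w) ψ(−a w)`** (`sum_units_eq_sum_ann`, `gaussSum_eq_sum_ann`).

For `R = 𝒪/𝔭^c`, `I = 𝔭^{⌈c/2⌉}/𝔭^c`, the annihilator is `A = 𝔭^{⌊c/2⌋}/𝔭^c`: at EVEN `c` it is `I` itself and the
inner sum is `|I|` (the stationary phase in one point, `GaussSumEvenConductor`); at ODD `c = 2m + 1` it is one step
bigger, `A/I ≅ 𝔽_q`, and the inner sum `Q(ρ, a) = ∑_{w ∈ A} ρ(1 + w) ψ(−a w)` is a QUADRATIC Gauss sum over the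
residue field (`w ↦ ρ(1 + w) ψ(−a w)` is `I`-periodic with `g(w) g(w') = g(w + w') ψ(a w w')`, `sum_ann_mul`) — the
structure behind gen 4's `OcticCMPointTruncThree` (`c = 3`: `𝔤 = |k| · G(χ_quad, ψ₀(·/2))`).  The root number is
`ε(½, ρ, ψ) = ρ(ϖ)^n κ ρ(a)^{−1} ψ(a) · Q(ρ⁻¹, −a)` (`LocalChar.eps_eq_mul_quad`).

**What this is not.**  The evaluation of `Q` (Gauss's sign theorem at odd conductors) is NOT here.  Nothing here
says anything about the status of the Hodge conjecture for CM abelian varieties, which is NOT proved.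
-/

set_option autoImplicit false

noncomputable section

open Finset Classical

namespace Summit.Ventures.HodgeRepro.GaussSumStability

variable {R : Type} [CommRing R] [Fintype R]

/-- The `ψ`-annihilator of `I`, as a `Finset`. -/
def annSet (ψ : AddChar R ℂ) (I : Ideal R) : Finset R := univ.filter (fun x => PsiAnn ψ I x)

/-- `x ∈ annSet ψ I ↔ PsiAnn ψ I x`. -/
theorem mem_annSet (ψ : AddChar R ℂ) (I : Ideal R) (x : R) : x ∈ annSet ψ I ↔ PsiAnn ψ I x := by
  simp [annSet]

/-- **The Gauss sum over the units reduces to the annihilator of `I`**: if `I · I = 0`, `ρ(1 + z) = ψ(a z)` on `I`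
with `a` a unit, and `1 + w` is a unit for every `w ∈ A = Ann_ψ(I)`, then
`∑_{y ∈ R^×} ρ(y) ψ(y) = ρ(−a) ψ(−a) · ∑_{w ∈ A} ρ(1 + w) ψ(−a w)` — the surviving coset `−a + A = {−a(1 + w)}`. -/
theorem sum_units_eq_sum_ann (ψ : AddChar R ℂ) (I : Ideal R) (hI : ∀ z ∈ I, ∀ z' ∈ I, z * z' = 0)
    (ρ : MulChar R ℂ) (a : Rˣ) (hρ : ∀ z ∈ I, ρ (1 + z) = ψ (a * z))
    (hunit : ∀ w ∈ annSet ψ I, IsUnit (1 + w)) :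
    ∑ y : Rˣ, ρ y * ψ y = ρ (-(a : R)) * ψ (-(a : R)) * ∑ w ∈ annSet ψ I, ρ (1 + w) * ψ (-(a : R) * w) := by
  rw [sum_eq_sum_psiAnn ψ I hI (fun x => ρ x) a (fun y z hz => by
      show ρ ((y : R) * (1 + z)) = ρ y * ψ (a * z)
      rw [map_mul, hρ z hz])]
  rw [← sum_filter, mul_sum]
  -- the bijection `w ↦ −a(1 + w)` from `A` onto the surviving units
  symm
  refine sum_bij (fun w hw => (-a : Rˣ) * (hunit w hw).unit) ?_ ?_ ?_ ?_
  · intro w hw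
    simp only [mem_filter, mem_univ, true_and]
    rw [Units.val_mul, IsUnit.unit_spec, Units.val_neg,
      show (a : R) + -(a : R) * (1 + w) = (-(a : R)) * w by ring]
    exact PsiAnn.mul_left ((mem_annSet ψ I w).1 hw) _
  · intro w hw w' hw' h
    have h1 : (hunit w hw).unit = (hunit w' hw').unit := mul_left_cancel h
    have h2 := congrArg Units.val h1
    rw [IsUnit.unit_spec, IsUnit.unit_spec] at h2
    exact add_left_cancel h2
  · intro y hy
    simp only [mem_filter, mem_univ, true_and] at hy
    have hw : -((a⁻¹ : Rˣ) : R) * ((a : R) + y) ∈ annSet ψ I :=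
      (mem_annSet ψ I _).2 (hy.mul_left _)
    refine ⟨-((a⁻¹ : Rˣ) : R) * ((a : R) + y), hw, ?_⟩
    apply Units.ext
    rw [Units.val_mul, IsUnit.unit_spec, Units.val_neg]
    have hinv := Units.mul_inv a
    linear_combination ((a : R) + y) * hinv
  · intro w hw
    rw [Units.val_mul, IsUnit.unit_spec, Units.val_neg]
    have e1 : ρ (-(a : R) * (1 + w)) = ρ (-(a : R)) * ρ (1 + w) := map_mul ρ _ _
    have e2 : ψ (-(a : R) * (1 + w)) = ψ (-(a : R)) * ψ (-(a : R) * w) := by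
      rw [← AddChar.map_add_eq_mul]
      congr 1
      ring
    rw [e1, e2]
    ring

/-- **The Gauss sum in Mathlib's normalisation**: `gaussSum ρ ψ = ρ(−a) ψ(−a) · ∑_{w ∈ A} ρ(1 + w) ψ(−a w)`. -/
theorem gaussSum_eq_sum_ann (ψ : AddChar R ℂ) (I : Ideal R) (hI : ∀ z ∈ I, ∀ z' ∈ I, z * z' = 0)
    (ρ : MulChar R ℂ) (a : Rˣ) (hρ : ∀ z ∈ I, ρ (1 + z) = ψ (a * z))
    (hunit : ∀ w ∈ annSet ψ I, IsUnit (1 + w)) :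
    gaussSum ρ ψ = ρ (-(a : R)) * ψ (-(a : R)) * ∑ w ∈ annSet ψ I, ρ (1 + w) * ψ (-(a : R) * w) := by
  rw [gaussSum_eq_sum_units, sum_units_eq_sum_ann ψ I hI ρ a hρ hunit]

omit [Fintype R] in
/-- **The inner sum is a quadratic Gauss sum**: the function `g(w) = ρ(1 + w) ψ(−a w)` on `A` satisfies
`g(w) g(w') = g(w + w') ψ(a w w')` whenever `w w' ∈ I` and `w w' (w + w') ∈ ker ψ`-type terms vanish — precisely:
if `w w' ∈ I` and `1 + w + w'` is a unit with `ρ(1 + w + w') ≠ 0`, then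
`ρ(1 + w) ρ(1 + w') = ρ(1 + w + w') · ψ(a w w' (1 + w + w')⁻¹)` (`(1 + w)(1 + w') = (1 + w + w')(1 + w w' (1 + w + w')⁻¹)`). -/
theorem sum_ann_mul (ψ : AddChar R ℂ) (I : Ideal R) (ρ : MulChar R ℂ) (a : Rˣ)
    (hρ : ∀ z ∈ I, ρ (1 + z) = ψ (a * z)) (w w' : R) (hww' : w * w' ∈ I) (u : Rˣ)
    (hu : (u : R) = 1 + w + w') :
    ρ (1 + w) * ρ (1 + w') = ρ (1 + w + w') * ψ (a * (w * w' * ((u⁻¹ : Rˣ) : R))) := by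
  have hfac : (1 + w) * (1 + w') = (1 + w + w') * (1 + w * w' * ((u⁻¹ : Rˣ) : R)) := by
    have hinv := Units.mul_inv u
    rw [hu] at hinv
    linear_combination (-(w * w')) * hinv
  rw [← map_mul, hfac, map_mul, hρ _ (I.mul_mem_right _ hww')]

/-- The even case recovered: when `A = I`, the inner sum is `|I|`. -/
theorem sum_ann_eq_card_of_even (ψ : AddChar R ℂ) (I : Ideal R) (hA : ∀ x, PsiAnn ψ I x ↔ x ∈ I)
    (ρ : MulChar R ℂ) (a : Rˣ) (hρ : ∀ z ∈ I, ρ (1 + z) = ψ (a * z)) :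
    ∑ w ∈ annSet ψ I, ρ (1 + w) * ψ (-(a : R) * w) = (Fintype.card I : ℂ) := by
  have hset : annSet ψ I = univ.filter (fun x => x ∈ I) := by
    ext x
    simp [annSet, hA]
  rw [hset, sum_filter]
  have hterm : ∀ w, (if w ∈ I then ρ (1 + w) * ψ (-(a : R) * w) else 0) = if w ∈ I then (1 : ℂ) else 0 :=
    fun w => by
      split_ifs with hw
      · rw [hρ w hw, ← AddChar.map_add_eq_mul, show (a : R) * w + -(a : R) * w = 0 by ring,
          AddChar.map_zero_eq_one]
      · rfl
  simp_rw [hterm]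
  rw [sum_boole, Fintype.card_subtype]

end Summit.Ventures.HodgeRepro.GaussSumStability

namespace Summit.Ventures.HodgeRepro.PeriodCloser.LocalChar

open GaussSumStability

variable {R : Type} [CommRing R] [Fintype R]

/-- **Kudla's root number through the annihilator sum**: `ε(½, ρ, ψ) = ρ(ϖ)^n κ · ρ(a)^{−1} ψ(a) · Q` with
`Q = ∑_{w ∈ A} ρ⁻¹(1 + w) ψ(a w)` (the inner sum of `ρ⁻¹`, whose stationary point is `−a`). -/
theorem eps_eq_mul_quad (κ : ℂ) (n : ℕ) (ρ : LocalChar R) (ψ : AddChar R ℂ) (I : Ideal R)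
    (hI : ∀ z ∈ I, ∀ z' ∈ I, z * z' = 0) (a : Rˣ) (hρ : Primitive ψ I ρ a)
    (hunit : ∀ w ∈ annSet ψ I, IsUnit (1 + w)) :
    eps κ n ρ ψ = ρ.piVal ^ n * κ * ((ρ.unit (a : R))⁻¹ * ψ (a : R) *
      ∑ w ∈ annSet ψ I, ρ.unit⁻¹ (1 + w) * ψ ((a : R) * w)) := by
  unfold eps gauss
  rw [gaussSum_eq_sum_ann ψ I hI ρ.unit⁻¹ (-a) (inv_primitive ψ I ρ.unit a hρ) hunit, Units.val_neg, neg_neg,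
    MulChar.inv_apply_eq_inv']

end Summit.Ventures.HodgeRepro.PeriodCloser.LocalChar

end
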